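import Summits.CriticalPhenomena.SAWScalingLimit.Theorems.MassRatio.Negative.Component
import Summits.CriticalPhenomena.SAWScalingLimit.Theorems.SAWDefectDecoherenceMassRatioRenewalDefs

/-!
# Renewal surgery for the box kernel, part A: the list-surgery toolkit

Crux `SAWDefectDecoherence.MassRatio` (stmt-CriticalPhenomena-8550), line `renewal-averaging-at-b`,
registered stub `stub_renewalSurgery : RenewalSurgery kernel` (vocabulary:
`Theorems/SAWDefectDecoherenceMassRatioRenewalDefs.lean` — `box`, `top`, `door`, `Splits`,
`NoSplit`, `kernel`, `bridgeMassOf`, `irrMassOf`, `RenewalSurgery`).  The stub is Kesten's bridge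
decomposition IN THE BOX, as two finite inequalities between `x_c`-masses of box walks
`HexMidEdgeSAW (box m p h W) (top m p h j) (door m p)` (read from the top mid-edge DOWN to the
door):
(A) concatenation of an irreducible upper bridge with a lower bridge, (B) splitting of a bridge at
its highest renewal level.  This file is the shared toolkit; part B
(`SAWDefectDecoherenceMassRatioRenewalSurgeryB.lean`) proves (A), (B) and the stub.

## Contents (namespace `…Theorems.MassRatio.Renewal.Surgery`)

* `sum_le_sum_of_injOn`, `sum_le_sum_of_surjOn` — the two abstract rearrangement inequalities
  (an injective, resp. covering, weight-compatible map between finite index sets);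
* `VS Λ a z` — the finite set of VERTEX LISTS of the walks `a → z` in `Λ` (all weights of the line
  are functions of the vertex list, so every kernel is a sum over `VS`: `kernel_eq`,
  `kernel_top_eq`); anatomy of box walks (`rows_of_mem`, `head?_of_mem`, `getLast?_of_mem`,
  `offset_of_mem`, `adj_of_mem`, `ne_nil_of_mem`);
* `TGT`, `SRC`, `wt`, `conc` — the target index set (offset, list), the source index set
  (level `k`, lower offset/list, upper offset/IRREDUCIBLE upper list in the translated box), its
  weight `x_c^{|lower|} x_c^{|upper|}`, and the concatenation map `(j + j', upper ++ lower)`;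
  normal forms `sum_kernel_eq`, `sum_kernel_mul_irr_eq` of the two sides of `RenewalSurgery`;
* renewal-level algebra: `splits_of_append_right`, `splits_append_right`, `splits_relevel`,
  `append_inj_of_rows`, `noSplit_append`;
* **`conc_injOn`** — concatenation is injective on the source index set: the level `k` is the
  HIGHEST renewal level of `upper ++ lower` (irreducibility of the upper piece forbids higher
  ones), the pieces are recovered by their rows, the offsets from the heads;
* `renewalSurgery_noSplit_self` (namespace `…Renewal`) — `NoSplit m h h` is vacuous (the registered
  sub-goal carried by this part file).

Sources: H. Kesten, J. Math. Phys. 4 (1963) 960–969; N. Madras, G. Slade, *The Self-Avoiding Walk*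
(1993) §4.2.  Design: everything is phrased for vertex lists (`List HexVertex`) and nested sigma
finsets, so that no dependent types of walks with varying endpoints are compared; walks are
rebuilt from lists with `Negative.mkSAW`.  Deliberately NOT here: the two inequalities (part B).
-/

noncomputable section

namespace Summit.CriticalPhenomena.SAWScalingLimit.Theorems.MassRatio.Renewal

open Literature.Probability.LatticeModels Literature.Probability.RandomPlanarGeometry
open Literature.Probability.RandomPlanarGeometry.SAW
open Summit.CriticalPhenomena.SAWScalingLimit.Theorems.MassRatio.Negative

namespace Surgery

/-! ### Two abstract rearrangement inequalities -/

/-- If `φ` is injective on `S`, maps `S` into `T`, and `w ≤ g ∘ φ` on `S` with `g ≥ 0` on `T`,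
then `Σ_S w ≤ Σ_T g`. [folklore] -/
theorem sum_le_sum_of_injOn {ι α : Type*} [DecidableEq α] {S : Finset ι} {T : Finset α}
    {w : ι → ℝ} {g : α → ℝ} (φ : ι → α) (hinj : Set.InjOn φ ↑S) (hmaps : ∀ s ∈ S, φ s ∈ T)
    (hle : ∀ s ∈ S, w s ≤ g (φ s)) (hg : ∀ t ∈ T, 0 ≤ g t) :
    ∑ s ∈ S, w s ≤ ∑ t ∈ T, g t :=
  calc ∑ s ∈ S, w s ≤ ∑ s ∈ S, g (φ s) := Finset.sum_le_sum hle
    _ = ∑ t ∈ S.image φ, g t := (Finset.sum_image hinj).symm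
    _ ≤ ∑ t ∈ T, g t :=
      Finset.sum_le_sum_of_subset_of_nonneg (Finset.image_subset_iff.2 hmaps) fun t ht _ => hg t ht

/-- If `φ` is injective on `S`, `T ⊆ φ(S)`, and `g ∘ φ ≤ w` on `S` with `g ≥ 0`, then
`Σ_T g ≤ Σ_S w`. [folklore] -/
theorem sum_le_sum_of_surjOn {ι α : Type*} [DecidableEq α] {S : Finset ι} {T : Finset α}
    {w : ι → ℝ} {g : α → ℝ} (φ : ι → α) (hinj : Set.InjOn φ ↑S)
    (hsurj : ∀ t ∈ T, ∃ s ∈ S, φ s = t) (hle : ∀ s ∈ S, g (φ s) ≤ w s) (hg : ∀ a, 0 ≤ g a) :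
    ∑ t ∈ T, g t ≤ ∑ s ∈ S, w s :=
  calc ∑ t ∈ T, g t ≤ ∑ t ∈ S.image φ, g t :=
        Finset.sum_le_sum_of_subset_of_nonneg (fun t ht => by
          obtain ⟨s, hs, rfl⟩ := hsurj t ht
          exact Finset.mem_image_of_mem φ hs) fun t _ _ => hg t
    _ = ∑ s ∈ S, g (φ s) := Finset.sum_image hinj
    _ ≤ ∑ s ∈ S, w s := Finset.sum_le_sum hle

/-! ### A lattice fact about the box -/

/-- The outer endpoint of a top mid-edge of a box of height `h ≥ 1` is not on the door (so
`top ≠ door` and box walks are nonempty lists). [folklore] -/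
theorem top_outer_not_mem_door {m p : ℤ} {h : ℕ} (j : ℤ) (hh : 1 ≤ h) :
    bv (m + h) (p + j) ∉ door m p := by
  rw [door, Sym2.mem_iff]
  rintro (h1 | h1)
  · have := (bv_inj h1).1; omega
  · have := (bv_inj h1).1; omega

/-! ### Vertex lists of box walks -/

/-- The (finite) set of vertex lists of the walks `a → z` inside `Λ`. [folklore] -/
def VS (Λ : Finset HexVertex) (a z : Sym2 HexVertex) : Finset (List HexVertex) :=
  (Finset.univ : Finset (HexMidEdgeSAW Λ a z)).image fun β => β.verts

/-- Membership in `VS`. [folklore] -/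
theorem mem_VS {Λ : Finset HexVertex} {a z : Sym2 HexVertex} {l : List HexVertex} :
    l ∈ VS Λ a z ↔ ∃ β : HexMidEdgeSAW Λ a z, β.verts = l := by
  simp [VS]

/-- A sum over the walks is a sum over their vertex lists. [folklore] -/
theorem sum_VS {Λ : Finset HexVertex} {a z : Sym2 HexVertex} (f : List HexVertex → ℝ) :
    ∑ l ∈ VS Λ a z, f l = ∑ β : HexMidEdgeSAW Λ a z, f β.verts := by
  unfold VS
  rw [Finset.sum_image fun β _ β' _ h => HexMidEdgeSAW.ext h]

/-- `VS` is monotone in the domain (`ofSubdomain`). [folklore] -/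
theorem mem_VS_mono {Λ Λ' : Finset HexVertex} (hsub : Λ' ⊆ Λ) {a z : Sym2 HexVertex}
    {l : List HexVertex} (hl : l ∈ VS Λ' a z) : l ∈ VS Λ a z := by
  obtain ⟨β, rfl⟩ := mem_VS.1 hl
  exact mem_VS.2 ⟨ofSubdomain hsub β, rfl⟩

section Anatomy

variable {m p : ℤ} {h W : ℕ} {j : ℤ} {l : List HexVertex}

/-- Coordinates of the vertices of a box walk. [folklore] -/
theorem rows_of_mem (hl : l ∈ VS (box m p h W) (top m p h j) (door m p)) :
    ∀ v ∈ l, m ≤ row v ∧ row v ≤ m + h - 1 ∧ p - W ≤ pos v ∧ pos v ≤ p + W := by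
  obtain ⟨β, rfl⟩ := mem_VS.1 hl
  exact fun v hv => mem_Rect.1 (β.subset v hv)

/-- The top mid-edge of a box walk is an edge of `ℍ`. [folklore] -/
theorem adj_of_mem (hl : l ∈ VS (box m p h W) (top m p h j) (door m p)) :
    hexGraph.Adj (bv (m + h) (p + j)) (bv (m + h - 1) (p + j)) := by
  obtain ⟨β, rfl⟩ := mem_VS.1 hl
  obtain ⟨he, -⟩ := β.fst_mem
  exact (SimpleGraph.mem_edgeSet hexGraph).1 he

/-- A box walk of positive height is nonempty. [folklore] -/
theorem ne_nil_of_mem (hl : l ∈ VS (box m p h W) (top m p h j) (door m p)) (hh : 1 ≤ h) :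
    l ≠ [] := by
  obtain ⟨β, rfl⟩ := mem_VS.1 hl
  exact fun h0 => top_outer_not_mem_door j hh (by rw [← β.eq_of_nil h0]; exact Sym2.mem_mk_left _ _)

/-- A box walk starts at the inner endpoint of its top mid-edge. [folklore] -/
theorem head?_of_mem (hl : l ∈ VS (box m p h W) (top m p h j) (door m p)) (hh : 1 ≤ h) :
    l.head? = some (bv (m + h - 1) (p + j)) := by
  have hne := ne_nil_of_mem hl hh
  obtain ⟨β, rfl⟩ := mem_VS.1 hl
  have hmem : β.verts.head hne ∈ top m p h j := β.head_mem _ (List.head?_eq_some_head hne)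
  have hbox := mem_Rect.1 (β.subset _ (List.head_mem hne))
  rw [List.head?_eq_some_head hne]
  rcases Sym2.mem_iff.1 hmem with h1 | h1
  · exfalso; rw [h1, row_bv] at hbox; omega
  · rw [h1]

/-- A box walk ends at the inner endpoint of the door. [folklore] -/
theorem getLast?_of_mem (hl : l ∈ VS (box m p h W) (top m p h j) (door m p)) (hh : 1 ≤ h) :
    l.getLast? = some (bv m p) := by
  have hne := ne_nil_of_mem hl hh
  obtain ⟨β, rfl⟩ := mem_VS.1 hl
  have hmem : β.verts.getLast hne ∈ door m p := β.getLast_mem _ (List.getLast?_eq_some_getLast hne)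
  have hbox := mem_Rect.1 (β.subset _ (List.getLast_mem hne))
  rw [List.getLast?_eq_some_getLast hne]
  rcases Sym2.mem_iff.1 hmem with h1 | h1
  · exfalso; rw [h1, row_bv] at hbox; omega
  · rw [h1]

/-- The lateral offset of the top mid-edge of a box walk is at most the window. [folklore] -/
theorem offset_of_mem (hl : l ∈ VS (box m p h W) (top m p h j) (door m p)) (hh : 1 ≤ h) :
    -(W : ℤ) ≤ j ∧ j ≤ W := by
  have hne := ne_nil_of_mem hl hh
  have hv := rows_of_mem hl _ (List.head_mem hne)
  have hhd := head?_of_mem hl hh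
  rw [List.head?_eq_some_head hne, Option.some_inj] at hhd
  rw [hhd, row_bv, pos_bv] at hv
  omega

end Anatomy

/-! ### The kernel as a sum over vertex lists -/

/-- `NoSplit m h h` is vacuous. [folklore] -/
theorem noSplit_self (m : ℤ) (h : ℕ) (l : List HexVertex) : NoSplit m h h l :=
  fun _ h1 h2 => absurd h2 (not_lt.2 h1)

open scoped Classical in
/-- The kernel as a sum over vertex lists. [folklore] -/
theorem kernel_eq (m p : ℤ) (t W h : ℕ) (j : ℤ) :
    kernel m p t W h j = ∑ l ∈ VS (box m p h W) (top m p h j) (door m p),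
      if NoSplit m t h l then hexCriticalFugacity ^ l.length else 0 := by
  rw [kernel, sum_VS]
  rfl

/-- The bridge kernel (`t = h`, no condition) as a sum over vertex lists. [folklore] -/
theorem kernel_top_eq (m p : ℤ) (W h : ℕ) (j : ℤ) :
    kernel m p h W h j =
      ∑ l ∈ VS (box m p h W) (top m p h j) (door m p), hexCriticalFugacity ^ l.length := by
  rw [kernel_eq]
  exact Finset.sum_congr rfl fun l _ => if_pos (noSplit_self m h l)

/-- Target index set: pairs (offset `J ∈ I`, vertex list of a box walk of height `h`, window `W`,
from `top m p h J`). [folklore] -/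
def TGT (m p : ℤ) (W h : ℕ) (I : Finset ℤ) : Finset (Σ _ : ℤ, List HexVertex) :=
  I.sigma fun J => VS (box m p h W) (top m p h J) (door m p)

/-- Membership in `TGT`. [folklore] -/
theorem mem_TGT {m p : ℤ} {W h : ℕ} {I : Finset ℤ} {y : Σ _ : ℤ, List HexVertex} :
    y ∈ TGT m p W h I ↔ y.1 ∈ I ∧ y.2 ∈ VS (box m p h W) (top m p h y.1) (door m p) :=
  Finset.mem_sigma

open scoped Classical in
/-- A sum of kernels over offsets as one sum over `TGT`. [folklore] -/
theorem sum_kernel_eq (m p : ℤ) (t W h : ℕ) (I : Finset ℤ) :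
    ∑ J ∈ I, kernel m p t W h J =
      ∑ y ∈ TGT m p W h I, if NoSplit m t h y.2 then hexCriticalFugacity ^ y.2.length else 0 := by
  unfold TGT
  rw [Finset.sum_sigma]
  exact Finset.sum_congr rfl fun J _ => kernel_eq m p t W h J

/-- Source index type: (level `k`, lower offset `j`, lower list, upper offset `j'`, upper list). -/
abbrev Src : Type := Σ _ : ℕ, Σ _ : ℤ, Σ _ : List HexVertex, Σ _ : ℤ, List HexVertex

open scoped Classical in
/-- Source index set: `k ∈ K`, `|j| ≤ V`, a lower bridge of height `k` (window `V`, offset `j`),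
`|j'| ≤ V'`, an IRREDUCIBLE upper bridge of height `h - k` in the translated box (window `V'`,
offset `j'`). [folklore] -/
def SRC (m p : ℤ) (V V' h : ℕ) (K : Finset ℕ) : Finset Src :=
  K.sigma fun k => (Finset.Icc (-(V : ℤ)) V).sigma fun j =>
    (VS (box m p k V) (top m p k j) (door m p)).sigma fun _ =>
      (Finset.Icc (-(V' : ℤ)) V').sigma fun j' =>
        (VS (box (m + k) (p + j) (h - k) V') (top (m + k) (p + j) (h - k) j')
          (door (m + k) (p + j))).filter fun l' => NoSplit (m + k) 1 (h - k) l'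

/-- Membership in `SRC`. [folklore] -/
theorem mem_SRC {m p : ℤ} {V V' h : ℕ} {K : Finset ℕ} {x : Src} :
    x ∈ SRC m p V V' h K ↔
      x.1 ∈ K ∧ (-(V : ℤ) ≤ x.2.1 ∧ x.2.1 ≤ V) ∧
      x.2.2.1 ∈ VS (box m p x.1 V) (top m p x.1 x.2.1) (door m p) ∧
      (-(V' : ℤ) ≤ x.2.2.2.1 ∧ x.2.2.2.1 ≤ V') ∧
      x.2.2.2.2 ∈ VS (box (m + x.1) (p + x.2.1) (h - x.1) V')
        (top (m + x.1) (p + x.2.1) (h - x.1) x.2.2.2.1) (door (m + x.1) (p + x.2.1)) ∧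
      NoSplit (m + x.1) 1 (h - x.1) x.2.2.2.2 := by
  simp only [SRC, Finset.mem_sigma, Finset.mem_filter, Finset.mem_Icc, and_assoc]

/-- The weight of a source index: `x_c^{|lower|} · x_c^{|upper|}`. [folklore] -/
def wt (x : Src) : ℝ :=
  hexCriticalFugacity ^ x.2.2.1.length * hexCriticalFugacity ^ x.2.2.2.2.length

/-- The double sum `Σ_k Σ_j κ(k-bridges) · irr(h-k)` as one sum over `SRC`. [folklore] -/
theorem sum_kernel_mul_irr_eq (m p : ℤ) (V V' h : ℕ) (K : Finset ℕ) :
    ∑ k ∈ K, ∑ j ∈ Finset.Icc (-(V : ℤ)) V,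
        kernel m p k V k j * irrMassOf kernel (m + k) (p + j) (h - k) V' =
      ∑ x ∈ SRC m p V V' h K, wt x := by
  classical
  unfold SRC
  simp only [Finset.sum_sigma]
  refine Finset.sum_congr rfl fun k _ => Finset.sum_congr rfl fun j _ => ?_
  rw [kernel_top_eq, Finset.sum_mul]
  refine Finset.sum_congr rfl fun l _ => ?_
  rw [irrMassOf, Finset.mul_sum]
  refine Finset.sum_congr rfl fun j' _ => ?_
  rw [kernel_eq, Finset.sum_filter, Finset.mul_sum]
  refine Finset.sum_congr rfl fun l' _ => ?_
  unfold wt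
  split_ifs <;> simp

/-- The concatenation map: (k, j, lower, j', upper) ↦ (j + j', upper ++ lower). [folklore] -/
def conc (x : Src) : Σ _ : ℤ, List HexVertex := ⟨x.2.1 + x.2.2.2.1, x.2.2.2.2 ++ x.2.2.1⟩

/-! ### Renewal levels -/

/-- A split of `l' ++ l` at a level above all rows of `l` restricts to a split of `l'`.
[folklore] -/
theorem splits_of_append_right {m : ℤ} {h' : ℕ} {l' l : List HexVertex}
    (hs : Splits m h' (l' ++ l)) (hl : ∀ v ∈ l, row v < m + h') : Splits m h' l' := by
  obtain ⟨l₁, l₂, he, h₁, h₂⟩ := hs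
  rcases List.append_eq_append_iff.1 he with ⟨c, rfl, rfl⟩ | ⟨c, rfl, rfl⟩
  · exact ⟨l', [], by simp, fun v hv => h₁ v (List.mem_append_left c hv), fun v hv => by simp at hv⟩
  · exact ⟨l₁, c, rfl, h₁, fun v hv => h₂ v (List.mem_append_left l hv)⟩

/-- A split of `l'` at a level above all rows of `l` extends to a split of `l' ++ l`. [folklore] -/
theorem splits_append_right {m : ℤ} {h' : ℕ} {l' l : List HexVertex}
    (hs : Splits m h' l') (hl : ∀ v ∈ l, row v < m + h') : Splits m h' (l' ++ l) := by
  obtain ⟨l₁, l₂, rfl, h₁, h₂⟩ := hs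
  refine ⟨l₁, l₂ ++ l, by simp, h₁, fun v hv => ?_⟩
  rcases List.mem_append.1 hv with hv | hv
  exacts [h₂ v hv, hl v hv]

/-- Re-basing the level of a split. [folklore] -/
theorem splits_relevel {m m' : ℤ} {a b : ℕ} {l : List HexVertex} (h : m + a = m' + b)
    (hs : Splits m a l) : Splits m' b l := by
  obtain ⟨l₁, l₂, rfl, h₁, h₂⟩ := hs
  exact ⟨l₁, l₂, rfl, fun v hv => h ▸ h₁ v hv, fun v hv => h ▸ h₂ v hv⟩

/-- Lists with rows `≥ r` followed by lists with rows `< r` concatenate injectively. [folklore] -/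
theorem append_inj_of_rows {r : ℤ} {a₁ b₁ a₂ b₂ : List HexVertex}
    (ha₁ : ∀ v ∈ a₁, r ≤ row v) (hb₁ : ∀ v ∈ b₁, row v < r) (ha₂ : ∀ v ∈ a₂, r ≤ row v)
    (hb₂ : ∀ v ∈ b₂, row v < r) (he : a₁ ++ b₁ = a₂ ++ b₂) : a₁ = a₂ ∧ b₁ = b₂ := by
  rcases List.append_eq_append_iff.1 he with ⟨c, rfl, rfl⟩ | ⟨c, rfl, rfl⟩
  · cases c with
    | nil => simp
    | cons v c => exact absurd (ha₂ v (by simp)) (not_le.2 (hb₁ v (by simp)))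
  · cases c with
    | nil => simp
    | cons v c => exact absurd (ha₁ v (by simp)) (not_le.2 (hb₂ v (by simp)))

/-- An irreducible upper piece on base row `m + k` stacked on a piece below row `m + k` has no
renewal level in `[t, h)` once `k < t`. [folklore] -/
theorem noSplit_append {m : ℤ} {k t h : ℕ} {l' l : List HexVertex} (hkt : k < t)
    (hl : ∀ v ∈ l, row v < m + k) (hirr : NoSplit (m + k) 1 (h - k) l') :
    NoSplit m t h (l' ++ l) := by
  intro h'' h1 h2 hsp
  have hs : Splits m h'' l' := splits_of_append_right hsp fun v hv => by have := hl v hv; omega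
  exact hirr (h'' - k) (by omega) (by omega) (splits_relevel (by omega) hs)

/-- **Injectivity of concatenation** on the source index set (all levels `k ∈ K` in `[1, h)`):
the level `k` is recovered as the highest renewal level, the pieces by their rows, the offsets
from the heads. [folklore] -/
theorem conc_injOn {m p : ℤ} {V V' h : ℕ} {K : Finset ℕ} (hK : ∀ k ∈ K, 1 ≤ k ∧ k < h) :
    Set.InjOn conc ↑(SRC m p V V' h K) := by
  -- no strict comparison of levels is possible
  have key : ∀ x₁ ∈ SRC m p V V' h K, ∀ x₂ ∈ SRC m p V V' h K, conc x₁ = conc x₂ →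
      ¬ x₁.1 < x₂.1 := by
    rintro ⟨k₁, j₁, l₁, j₁', l₁'⟩ hx₁ ⟨k₂, j₂, l₂, j₂', l₂'⟩ hx₂ he hlt
    simp only [mem_SRC] at hx₁ hx₂
    obtain ⟨hk₁, -, hl₁, -, hl₁', hirr₁⟩ := hx₁
    obtain ⟨hk₂, -, hl₂, -, hl₂', -⟩ := hx₂
    simp only [conc, Sigma.mk.inj_iff, heq_eq_eq] at he
    obtain ⟨hK₁, -⟩ := hK k₁ hk₁
    obtain ⟨-, hK₂h⟩ := hK k₂ hk₂
    dsimp only at hlt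
    have hs : Splits m k₂ (l₁' ++ l₁) := by
      rw [he.2]
      exact ⟨l₂', l₂, rfl, fun v hv => (rows_of_mem hl₂' v hv).1, fun v hv => by
        have := (rows_of_mem hl₂ v hv).2.1; omega⟩
    have hs' : Splits (m + k₁) (k₂ - k₁) l₁' :=
      splits_relevel (by omega)
        (splits_of_append_right hs fun v hv => by have := (rows_of_mem hl₁ v hv).2.1; omega)
    exact hirr₁ (k₂ - k₁) (by omega) (by omega) hs'
  intro x₁ hx₁ x₂ hx₂ he
  have h12 := key x₁ hx₁ x₂ hx₂ he
  have h21 := key x₂ hx₂ x₁ hx₁ he.symm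
  obtain ⟨k₁, j₁, l₁, j₁', l₁'⟩ := x₁
  obtain ⟨k₂, j₂, l₂, j₂', l₂'⟩ := x₂
  dsimp only at h12 h21
  obtain rfl : k₁ = k₂ := by omega
  simp only [Finset.mem_coe, mem_SRC] at hx₁ hx₂
  obtain ⟨hk₁, -, hl₁, -, hl₁', -⟩ := hx₁
  obtain ⟨-, -, hl₂, -, hl₂', -⟩ := hx₂
  obtain ⟨hK₁, -⟩ := hK k₁ hk₁
  simp only [conc, Sigma.mk.inj_iff, heq_eq_eq] at he
  obtain ⟨hjj, hll⟩ := he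
  obtain ⟨rfl, rfl⟩ : l₁' = l₂' ∧ l₁ = l₂ :=
    append_inj_of_rows (r := m + k₁) (fun v hv => (rows_of_mem hl₁' v hv).1)
      (fun v hv => by have := (rows_of_mem hl₁ v hv).2.1; omega)
      (fun v hv => (rows_of_mem hl₂' v hv).1)
      (fun v hv => by have := (rows_of_mem hl₂ v hv).2.1; omega) hll
  have hh := (head?_of_mem hl₁ hK₁).symm.trans (head?_of_mem hl₂ hK₁)
  obtain rfl : j₁ = j₂ := by have := (bv_inj (Option.some.inj hh)).2; omega
  obtain rfl : j₁' = j₂' := by omega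
  rfl

end Surgery

/-- `NoSplit m h h l` holds for every vertex list: there is no level `h'` with `h ≤ h' < h`
(so `bridgeMassOf kernel` counts ALL box walks). Registered sub-goal of the toolkit part of
`stub_renewalSurgery`. [folklore] -/
theorem renewalSurgery_noSplit_self : ∀ (m : ℤ) (h : ℕ) (l : List HexVertex), NoSplit m h h l :=
  Surgery.noSplit_self

end Summit.CriticalPhenomena.SAWScalingLimit.Theorems.MassRatio.Renewal
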